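import Summits.ABC.IUTFork.Cor312NotPointwiseDHVol
import Summits.ABC.IUTFork.Cor312VolumesPadicLatticeScaled
import HarnessLib

/-!
# [IUTchIII] Cor. 3.12, statement — the summand-wise scaled log-shell lattices `Π_{v⃗} c(v⃗)·I_{v⃗}` of a real prime
# packet, read BLOCK BY BLOCK in field-factor coordinates: membership, inner and outer radii per summand

PROOF-ONLY support piece of the abc-iut cell (R2 S-chain team, seat abc-iut-s2-p6; generic half of the per-tuple upper
bound on `−|log(Θ)|_{j,p}` at the print-normalised real setting, companion `Cor312ThetaLocalUpperPrVolTuple`). TAKES NO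
SIDE on [IUTchIII] Cor. 3.12; theorems only, 0 `def`s. For a `p`-adic presentation `P` of abc-iut-c312-5
(`Cor312VolumesPadicSummands`; Dupuy–Hilado arXiv:2004.13228 §4 intro "the `ℤ_p`-lattice `I^{⊗ j+1}_{V̲,p} = ⊕_{v⃗} I_{v⃗}`")
and a scalar FUNCTION `c` on the summands `v⃗`, abc-iut-c312-5 (gen 4)'s `latticePkS c = e⁻¹(Π_{v⃗} c(v⃗)·I_{v⃗})`
(`Cor312VolumesPadicLatticeScaled`) is here read on the field-factor coordinates `(ψ_{v⃗}(e(x)_{v⃗})_i)_{(v⃗,i)}` of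
abc-iut-c312-3's decompositions ([IUTchIV] Prop. 1.4 (i)):

* `mem_latticePkS_iff_factorMap` — block by block;
* `block_mem_image_smul_logShell_of_norm_le` — INNER radius per block: a `v⃗`-block in the polydisc of radius
  `ρ < ‖c‖·r` lies in `ψ_{v⃗}(c·I_{v⃗})` (`r` an inner radius of `latticeF 1`);
* `norm_le_of_block_mem_image_smul_logShell` — OUTER radius per block: a block in `ψ_{v⃗}(c·I_{v⃗})` has coordinates
  of norm `≤ ‖c‖·R` (`R` an outer radius of `latticeF 1`);
both by zero-extension to the other blocks and abc-iut-w4-d107's scalar sandwich (`Cor312NotPointwiseDHVol`: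
`subset_latticeF_of_norm_le`, `norm_le_of_mem_latticeF`). [cite: DupuyHilado2025, §4 (intro), §4.10]
[cite: Mochizuki2012, IUTchIV Prop. 1.4 (i) p. 13] [claim: Mochizuki2012, status: disputed] Nothing here bears on the
truth of [IUTchIII] Cor. 3.12; typed ≠ proved.
-/

noncomputable section

open Set Function
open scoped Pointwise

namespace Summit.ABC

namespace IUTFork

namespace Cor312Vol

namespace PadicPresentation

open Thm311 Literature.IUT.LogThetaLattice Literature.IUT.LogVolume

variable {T : ThetaIndex} {L : LogShells T} {vQ : T.VQ} {p : ℕ} [hp : Fact p.Prime] (P : PadicPresentation L vQ p)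
  {j : T.Label}

/-- Membership in the summand-wise scaled lattice packet `e⁻¹(Π_{v⃗} c(v⃗)·I_{v⃗})` is read block by block on the
field-factor coordinates `(ψ_{v⃗}(e(x)_{v⃗})_i)_i`. [cite: DupuyHilado2025, §4 (intro)] -/
theorem mem_latticePkS_iff_factorMap (c : (T.Caps j → T.Fibre vQ) → ℚ_[p]) (x : L.Packet j vQ) :
    x ∈ P.latticePkS j c ↔
      ∀ e, (fun i => P.factorMap j x ⟨e, i⟩) ∈ dEquiv p (P.kk e) '' (c e • logShell p (P.kk e)) := by
  show P.comparison j x ∈ P.summandLatticeS j c ↔ _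
  rw [P.mem_summandLatticeS_iff]
  refine forall_congr' fun e => ?_
  have hfun : (fun i => P.factorMap j x ⟨e, i⟩) = dEquiv p (P.kk e) (P.comparison j x e) := rfl
  rw [hfun, (dEquiv p (P.kk e)).injective.mem_set_image]

/-- **Inner radius, per block**: if the coordinate ball of radius `r` lies in `latticeF 1` and `0 ≤ ρ < ‖c‖·r`
(`c ≠ 0`), then every family whose `v⃗`-block lies in the polydisc of radius `ρ` has that block in `ψ_{v⃗}(c·I_{v⃗})`
(zero-extend the block and apply abc-iut-c312-5's scalar `subset_latticeF_of_norm_le`). [cite: DupuyHilado2025, §4.10] -/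
theorem block_mem_image_smul_logShell_of_norm_le {r ρ : ℝ}
    (hball : ∀ z : (∀ s : (Σ e : T.Caps j → T.Fibre vQ, DIdx p (P.kk e)), DFac p (P.kk s.1) s.2),
      (∀ s, ‖z s‖ < r) → z ∈ P.latticeF j 1)
    {c : ℚ_[p]} (hc : c ≠ 0) (hρ0 : 0 ≤ ρ) (hρ : ρ < ‖c‖ * r)
    (z : ∀ s : (Σ e : T.Caps j → T.Fibre vQ, DIdx p (P.kk e)), DFac p (P.kk s.1) s.2)
    (e : T.Caps j → T.Fibre vQ) (hz : ∀ i, ‖z ⟨e, i⟩‖ ≤ ρ) :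
    (fun i => z ⟨e, i⟩) ∈ dEquiv p (P.kk e) '' (c • logShell p (P.kk e)) := by
  classical
  set z' : ∀ s : (Σ e : T.Caps j → T.Fibre vQ, DIdx p (P.kk e)), DFac p (P.kk s.1) s.2 :=
    fun s => if s.1 = e then z s else 0 with hz'
  have hnorm : ∀ s, ‖z' s‖ ≤ ρ := by
    rintro ⟨e', i⟩
    by_cases h : e' = e
    · subst h
      simp only [hz', if_pos rfl]
      exact hz i
    · simp only [hz', if_neg h, norm_zero]
      exact hρ0
  have hmem : z' ∈ P.latticeF j c := P.subset_latticeF_of_norm_le hball hc hρ hnorm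
  have hblock := (P.mem_latticeF_iff c z').1 hmem e
  have heq : (fun i => z' ⟨e, i⟩) = fun i => z ⟨e, i⟩ := funext fun i => by simp only [hz', if_pos rfl]
  rwa [heq] at hblock

/-- **Outer radius, per block**: if `latticeF 1` lies in the coordinate polydisc of radius `R`, then a block lying in
`ψ_{v⃗}(c·I_{v⃗})` (`c ≠ 0`) has all its coordinates of norm `≤ ‖c‖·R` (zero-extend and apply abc-iut-c312-5's scalar
`norm_le_of_mem_latticeF`; `0 ∈ ψ_{v⃗'}(c·I_{v⃗'})`). [cite: DupuyHilado2025, §4 (intro)] -/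
theorem norm_le_of_block_mem_image_smul_logShell {R : ℝ}
    (hbdd : ∀ z ∈ P.latticeF j 1, ∀ s, ‖z s‖ ≤ R) {c : ℚ_[p]} (hc : c ≠ 0)
    (z : ∀ s : (Σ e : T.Caps j → T.Fibre vQ, DIdx p (P.kk e)), DFac p (P.kk s.1) s.2)
    (e : T.Caps j → T.Fibre vQ) (hz : (fun i => z ⟨e, i⟩) ∈ dEquiv p (P.kk e) '' (c • logShell p (P.kk e)))
    (i : DIdx p (P.kk e)) : ‖z ⟨e, i⟩‖ ≤ ‖c‖ * R := by
  classical
  set z' : ∀ s : (Σ e : T.Caps j → T.Fibre vQ, DIdx p (P.kk e)), DFac p (P.kk s.1) s.2 :=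
    fun s => if s.1 = e then z s else 0 with hz'
  have hmem : z' ∈ P.latticeF j c := by
    rw [P.mem_latticeF_iff]
    intro e'
    by_cases h : e' = e
    · subst h
      have heq : (fun i => z' ⟨e', i⟩) = fun i => z ⟨e', i⟩ := funext fun i => by simp only [hz', if_pos rfl]
      rw [heq]
      exact hz
    · have heq : (fun i => z' ⟨e', i⟩) = (0 : DSum p (P.kk e')) := funext fun i => by
        simp only [hz', if_neg h]; rfl
      rw [heq]
      exact P.zero_mem_image_smul_logShell e' c
  have h := P.norm_le_of_mem_latticeF hbdd hc hmem ⟨e, i⟩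
  simp only [hz', if_pos rfl] at h
  exact h

end PadicPresentation

end Cor312Vol

end IUTFork

end Summit.ABC

end
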